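import Summits.QuantumAdvantage.QuantumAdvantage.Theorems.CubicForrelationNearExactIsExactTwelveLevelFivePartnerGt2932
import Summits.QuantumAdvantage.QuantumAdvantage.Theorems.CubicForrelationNearExactIsExactTwelveTypeO931Shape

/-!
# Crux `CubicForrelation.NearExactIsExact` (stmt-QuantumAdvantage-14043) — n = 12, level 5 at `Φ ≥ 929/1024`: REDUCTION to a single
  configuration (`Φ = 929/1024` exactly, the partner is type O with the 9-flat base set `#E = 512` and a residual spike `≥ 23`)

Certificate seat `b2b-cforr-cert` (gen 20).  HONEST FRAMING: a kernel-checked reduction (standard axioms) for the NEXT undecided value `929/1024` on the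
`n = 12` ladder; it kills nothing by itself (the base-`512` boundary configuration of the partner remains: HOME/b2b-cforr-cert-g20/PLAN-N12-929.md).
NOT summit progress, NO new value of `θ₁₂`.

`tw20_levelFive_ge929_reduction`: cubic `f, g` on 12 bits, `W_g = 32u'` with some `u'(x)` odd, `Φ(f,g) ≥ 929/1024`.  Then `Φ(f,g) = 929/1024`, and
the partner has `W_f = 16u_f` with every `u_f` odd, base set `#E_f = 512`, and a point with `|u_f − 4(−1)^g| ≥ 23`.  Proof: by
`tw20_levelFive_gt2932_partner` the partner is type O with a spike `|τ(y⋆)| ≥ 23`, `τ = u_f − 4(−1)^g`; by `to19_typeO_gt2932_shape` for the pair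
`(g, f)` its base set has `512`, `960` or `992` points and `Σ τ² = 2¹⁷(1 − Φ) ≤ 12160`; but `τ` is odd, `≡ ±3 (mod 8)` on `E_f` (so `τ² ≥ 9`
there) and `τ(y⋆)² ≥ 529`, whence `Σ τ² ≥ 4096 + 8·#E_f + 520`, i.e. `#E_f ≤ 943`: the base set is the 9-flat (`512`), and then
`to19_typeO_E512_le_929` gives `Φ ≤ 929/1024`.

References: J. Ax (1964) / R. J. McEliece (1972); T. Kasami, N. Tokura (1970); MacWilliams–Sloane (1977) Ch. 13–15.  Everything below is proved from
Mathlib and the tree; axioms are the standard three.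
-/

set_option linter.dupNamespace false -- D-0017: single-problem summit ⇒ `QuantumAdvantage.QuantumAdvantage` by design

noncomputable section

namespace Summit.QuantumAdvantage.QuantumAdvantage.Theorems.CubicForrelation.NearExactIsExact

open Finset
open Literature.Computability.QuantumComplexity
open Literature.Computability.QuantumComplexity.DerivativeWalsh (W)

/-- **Level 5 at `Φ ≥ 929/1024`: only the value `929/1024` with a base-`512` type-O partner carrying a spike can occur.**  See the module
docstring.  Finite-slice statement, NOT summit progress. [this work] -/
theorem tw20_levelFive_ge929_reduction (f g : (Fin (6 + 6) → Bool) → Bool) (hf : IsDegLeFun 3 f) (hg : IsDegLeFun 3 g)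
    (u' : (Fin (6 + 6) → Bool) → ℤ) (hu' : ∀ x, W (fun y => signOf (g y)) x = (2 : ℝ) ^ 5 * (u' x : ℝ))
    (hodd : ∃ x, Odd (u' x)) (hΦ : (929 / 1024 : ℝ) ≤ forrelation f g) :
    forrelation f g = 929 / 1024 ∧
    ∃ uf : (Fin (6 + 6) → Bool) → ℤ, (∀ y, W (fun x => signOf (f x)) y = (2 : ℝ) ^ 4 * (uf y : ℝ)) ∧ (∀ y, Odd (uf y)) ∧
      #(univ.filter fun y : Fin (6 + 6) → Bool => (Odd (uf y / 2) ↔ Odd (uf y / 2 / 2))) = 512 ∧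
      ∃ y, 23 ≤ |uf y - 4 * sZ (g y)| := by
  classical
  have hΦ' : forrelation g f = forrelation f g := by
    rw [Summit.QuantumAdvantage.QuantumAdvantage.Theorems.SignedCubicForrelationNotPrBPP.Negative.HalfQuad.forrelation_comm]
  obtain ⟨uf, huf, hoddf, y₁, hy₁⟩ := tw20_levelFive_gt2932_partner f g hf hg u' hu' hodd (by linarith)
  have hlo' : (29 / 32 : ℝ) < forrelation g f := by rw [hΦ']; linarith
  obtain ⟨hshape, hge, hbud⟩ := to19_typeO_gt2932_shape g f hg hf uf huf ⟨y₁, hoddf y₁⟩ hlo'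
  set E := univ.filter (fun y : Fin (6 + 6) → Bool => (Odd (uf y / 2) ↔ Odd (uf y / 2 / 2))) with hEdef
  set τ : (Fin (6 + 6) → Bool) → ℤ := fun y => uf y - 4 * sZ (g y) with hτdef
  -- the budget `Σ τ² ≤ 12160`
  have hT : (∑ y, τ y ^ 2 : ℤ) ≤ 12160 := by
    have h' : ((∑ y, (uf y - 4 * sZ (g y)) ^ 2 : ℤ) : ℝ) ≤ 12160 := by rw [hbud, hΦ']; linarith
    exact_mod_cast h'
  -- pointwise lower bounds
  have hτ1 : ∀ y, 1 ≤ τ y ^ 2 := by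
    intro y
    have h0 := Int.odd_iff.1 (hoddf y)
    have : τ y ≤ -1 ∨ 1 ≤ τ y := by
      simp only [τ]; rcases tp_sZ_cases (g y) with hs | hs <;> rw [hs] <;> omega
    have := tp_sq_ge (k := 1) (by norm_num) this
    linarith
  have hτ9 : ∀ y ∈ E, 9 ≤ τ y ^ 2 := by
    intro y hy
    have hE' : (Odd (uf y / 2) ↔ Odd (uf y / 2 / 2)) := (mem_filter.1 hy).2
    have h0 := Int.odd_iff.1 (hoddf y)
    have key : τ y ≤ -3 ∨ 3 ≤ τ y := by
      simp only [τ]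
      rw [Int.odd_iff, Int.odd_iff] at hE'
      rcases tp_sZ_cases (g y) with hs | hs <;> rw [hs] <;> omega
    have := tp_sq_ge (k := 3) (by norm_num) key
    linarith
  have hτ529 : 529 ≤ τ y₁ ^ 2 := by
    have h := hy₁
    change 23 ≤ |τ y₁| at h
    nlinarith [sq_abs (τ y₁), abs_nonneg (τ y₁)]
  -- `Σ τ² ≥ 4096 + 8·#E + 520`
  have hsum : 4096 + 8 * (#E : ℤ) + 520 ≤ ∑ y, τ y ^ 2 := by
    -- weights: `9` on `E`, `1` off `E`, plus the spike's excess `520` at `y₁`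
    have hpt : ∀ y, (if y ∈ E then (9 : ℤ) else 1) + (if y = y₁ then 520 else 0) ≤ τ y ^ 2 := by
      intro y
      by_cases hyE : y ∈ E <;> by_cases hy1 : y = y₁
      · rw [if_pos hyE, if_pos hy1]; subst hy1; linarith
      · rw [if_pos hyE, if_neg hy1, add_zero]; exact hτ9 y hyE
      · rw [if_neg hyE, if_pos hy1]; subst hy1; linarith
      · rw [if_neg hyE, if_neg hy1, add_zero]; exact hτ1 y
    have h1 : ∑ y, ((if y ∈ E then (9 : ℤ) else 1) + (if y = y₁ then 520 else 0)) ≤ ∑ y, τ y ^ 2 := sum_le_sum fun y _ => hpt y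
    rw [sum_add_distrib, sum_ite_eq' univ y₁, if_pos (mem_univ _)] at h1
    have h2 : ∑ y, (if y ∈ E then (9 : ℤ) else 1) = 4096 + 8 * (#E : ℤ) := by
      rw [← sum_filter_add_sum_filter_not univ (fun y => y ∈ E)]
      have e1 : (univ.filter fun y : Fin (6 + 6) → Bool => y ∈ E) = E := by ext y; simp
      rw [e1, sum_congr rfl fun y hy => if_pos hy, sum_congr rfl fun y hy => if_neg (mem_filter.1 hy).2, sum_const, sum_const,
        nsmul_eq_mul, nsmul_eq_mul]
      have hc := card_filter_add_card_filter_not (s := (univ : Finset (Fin (6 + 6) → Bool))) (fun y => y ∈ E)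
      rw [e1, card_univ, Fintype.card_fun, Fintype.card_bool, Fintype.card_fin] at hc
      have hc' : (#(univ.filter fun y : Fin (6 + 6) → Bool => y ∉ E) : ℤ) = 4096 - #E := by
        have : ((#E + #(univ.filter fun y : Fin (6 + 6) → Bool => ¬ y ∈ E) : ℕ) : ℤ) = ((2 ^ 12 : ℕ) : ℤ) := by exact_mod_cast hc
        push_cast at this
        linarith
      rw [hc']; ring
    linarith
  -- hence the base set is the 9-flat
  have hE512 : #E = 512 := by
    rcases hshape with ⟨h512, -⟩ | h960 | ⟨h992, -⟩
    · exact h512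
    · exfalso; rw [h960] at hsum; push_cast at hsum; linarith
    · exfalso; rw [h992] at hsum; push_cast at hsum; linarith
  have hle := to19_typeO_E512_le_929 g f hg hf uf huf ⟨y₁, hoddf y₁⟩ hE512
  rw [hΦ'] at hle
  exact ⟨le_antisymm hle hΦ, uf, huf, hoddf, hE512, y₁, hy₁⟩

end Summit.QuantumAdvantage.QuantumAdvantage.Theorems.CubicForrelation.NearExactIsExact

end
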